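import Literature.MathematicalPhysics.QuantumFieldTheory.Balaban1983to89.B15Prop1HessianNondegenerateOfRealCoercive

/-!
# `Balaban1983to89.B15Prop1SliceComplexification` — [Balaban1985Variational] = «[15]», Sect. G p. 305 («we fix a gauge condition»), p. 307 («the equations … are valid for
# Gᶜ-valued fields»); [Balaban1989LargeFieldI] = «[IV]», Prop. 1 p. 194 («B′ ∈ 𝔤ᶜ», last clause «real for real arguments»):
# THE COMPLEXIFICATION OF A REAL GAUGE SLICE — a conjugation-stable complex slice `S ≤ (PBond → ℂ³)` whose real fields are exactly the given real slice

Honest framing: statement-level skeleton of published theorems with citation tags; proofs where landed; nothing here is a claim about the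
Yang–Mills mass gap.  Cell `pub-ymgap`, HUMAN RULING D-0149 (width seats), seat `pub-ymgap-dag-n12-w1` (g2; N12 = [B15]; U1a⁺ of the w1 lineage);
count-neutral; N12 NOT discharged; finite 𝕋⁴ at fixed ε; nothing continuum ∕ OS ∕ mass-gap ∕ Clay.

WHY.  The w1 lineage's minimiser-family theorems (`B15Prop1LocalChartAtBaseField.exists_localChart_at_baseField`, `B15Prop1MinimiserFamilyFromRightInverse.hMin_[atRecord_]of_…`)
take per base field a CONJUGATION-STABLE COMPLEX slice `S : Submodule ℂ (PBond P 0 → ℂ³)` (`∀ X ∈ S, conjVec X ∈ S`), and phrase the real letters (the right inverse `hH`, the real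
(β) positivity) over the REAL fields of the slice, `cplxVec p ∈ S`.  The sibling lanes' gauge conditions are REAL subspaces of bond fields (`B16Ineq19NearFlatSlice`'s
`GaugeSlice S T ℝ³` with `ιA`, n07's axial slices).  THIS MODULE is the junction: every real slice `Sr ≤ (PBond P j → ℝ³)` has a conjugation-stable complexification `S` with
`cplxVec p ∈ S ↔ p ∈ Sr` and `S = cplxVec Sr ⊕ i·cplxVec Sr` — so consumers state their letters over `p ∈ Sr`.  Existence as a theorem (the witness is the ℂ-span of `cplxVec '' Sr`);
no new definition.

CONTENTS (theorems only; no `def`, no `instance`, no `sorry`).  `re_cplxVec`, `re_I_smul_cplxVec`, `conjVec_mem_span_cplxVec`, `re_mem_of_mem_span_cplxVec`,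
`eq_cplxVec_re_add_I_smul`, ★★ `exists_sliceComplexification`.
HONEST SCOPE: linear algebra; nothing of Bałaban's asserted; count-neutral; N12 NOT discharged; the YM mass gap (Clay) is NOT proved by any of this — R4 closes only the conditional
finite-𝕋⁴ rung `BalabanLadder.UV`.
-/

noncomputable section

namespace Literature.MathematicalPhysics.QuantumFieldTheory.Balaban1983to89.B15Prop1SliceComplexification

open scoped ComplexConjugate
open Literature.MathematicalPhysics.QuantumFieldTheory.Balaban1983to89.B15ComplexifiedDatumFamily (conjVec conjVec_cplxVec)
open B15Prop1StateChartSU2 (exists_conjCLM)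
open B15Prop1HessianNondegenerateOfRealCoercive (cplxVec_add cplxVec_smul)
open B15Prop1AnalyticExtClause (cplxVec)
open B15Prop1ChartCalculusSU2 (E3)
open T4Continuum GaugeField

variable {P : Params} {j : ℕ}

/-- The real part of `cplxVec p` is `p` (componentwise). [cite: Balaban1989LargeFieldI, Prop. 1 p.194 (bookkeeping)] -/
theorem re_cplxVec (p : VecField P j E3) (b : PBond P j) (a : Fin 3) : (cplxVec p b a).re = p b a := by
  simp [cplxVec]

/-- The real part of `i · cplxVec p` vanishes (componentwise). [cite: Balaban1989LargeFieldI, Prop. 1 p.194 (bookkeeping)] -/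
theorem re_I_smul_cplxVec (p : VecField P j E3) (b : PBond P j) (a : Fin 3) : ((Complex.I • cplxVec p) b a).re = 0 := by
  simp [cplxVec]

/-- **THE ℂ-SPAN OF A SET OF REAL FIELDS IS CONJUGATION-STABLE.** [cite: Balaban1985Variational, Sect. G p.307 («valid for Gᶜ-valued fields»); Balaban1989LargeFieldI, Prop. 1 p.194] -/
theorem conjVec_mem_span_cplxVec (R : Set (VecField P j E3)) {X : VecField P j (EuclideanSpace ℂ (Fin 3))}
    (hX : X ∈ Submodule.span ℂ (cplxVec '' R)) : conjVec X ∈ Submodule.span ℂ (cplxVec '' R) := by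
  obtain ⟨c, hc⟩ := exists_conjCLM (P := P) (j := j)
  have hle : Submodule.span ℂ (cplxVec '' R) ≤ (Submodule.span ℂ (cplxVec '' R)).comap (c : VecField P j (EuclideanSpace ℂ (Fin 3)) →ₛₗ[starRingEnd ℂ]
      VecField P j (EuclideanSpace ℂ (Fin 3))) := by
    refine Submodule.span_le.2 ?_
    rintro _ ⟨p, hp, rfl⟩
    show c (cplxVec p) ∈ Submodule.span ℂ (cplxVec '' R)
    rw [hc, conjVec_cplxVec]
    exact Submodule.subset_span ⟨p, hp, rfl⟩
  have h := hle hX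
  rw [Submodule.mem_comap] at h
  rw [← hc]
  exact h

/-- **REAL AND IMAGINARY PARTS OF A FIELD IN THE ℂ-SPAN OF A REAL SUBMODULE LIE IN IT**: for `X ∈ span_ℂ (cplxVec '' Sr)`, the componentwise real parts of `X` and of `i·X` are
in `Sr`. [cite: Balaban1989LargeFieldI, Prop. 1 p.194 («B′ ∈ 𝔤ᶜ»; bookkeeping)] -/
theorem re_mem_of_mem_span_cplxVec (Sr : Submodule ℝ (VecField P j E3)) {X : VecField P j (EuclideanSpace ℂ (Fin 3))}
    (hX : X ∈ Submodule.span ℂ (cplxVec '' (Sr : Set (VecField P j E3)))) :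
    (fun b => WithLp.toLp 2 fun a => (X b a).re : VecField P j E3) ∈ Sr ∧
      (fun b => WithLp.toLp 2 fun a => ((Complex.I • X) b a).re : VecField P j E3) ∈ Sr := by
  induction hX using Submodule.span_induction with
  | mem Y hY =>
    obtain ⟨p, hp, rfl⟩ := hY
    constructor
    · have hfun : (fun b => WithLp.toLp 2 fun a => (cplxVec p b a).re : VecField P j E3) = p := by
        funext b; ext a; simp [cplxVec]
      rw [hfun]; exact hp
    · have hfun : (fun b => WithLp.toLp 2 fun a => ((Complex.I • cplxVec p) b a).re : VecField P j E3) = 0 := by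
        funext b; ext a; simp [cplxVec]
      rw [hfun]; exact Sr.zero_mem
  | zero =>
    constructor
    · have hfun : (fun b => WithLp.toLp 2 fun a => ((0 : VecField P j (EuclideanSpace ℂ (Fin 3))) b a).re : VecField P j E3) = 0 := by
        funext b; ext a; simp
      rw [hfun]; exact Sr.zero_mem
    · have hfun : (fun b => WithLp.toLp 2 fun a => ((Complex.I • (0 : VecField P j (EuclideanSpace ℂ (Fin 3)))) b a).re : VecField P j E3) = 0 := by
        funext b; ext a; simp
      rw [hfun]; exact Sr.zero_mem
  | add Y Z _ _ hY hZ =>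
    constructor
    · have hfun : (fun b => WithLp.toLp 2 fun a => ((Y + Z) b a).re : VecField P j E3) =
          (fun b => WithLp.toLp 2 fun a => (Y b a).re : VecField P j E3) + (fun b => WithLp.toLp 2 fun a => (Z b a).re : VecField P j E3) := by
        funext b; ext a; simp
      rw [hfun]; exact Sr.add_mem hY.1 hZ.1
    · have hfun : (fun b => WithLp.toLp 2 fun a => ((Complex.I • (Y + Z)) b a).re : VecField P j E3) =
          (fun b => WithLp.toLp 2 fun a => ((Complex.I • Y) b a).re : VecField P j E3) +
            (fun b => WithLp.toLp 2 fun a => ((Complex.I • Z) b a).re : VecField P j E3) := by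
        funext b; ext a; simp
      rw [hfun]; exact Sr.add_mem hY.2 hZ.2
  | smul z Y _ hY =>
    -- `Re (z Y) = Re z · Re Y + Im z · Re (i Y)`, `Re (i z Y) = Re z · Re (i Y) − Im z · Re Y`
    constructor
    · have hfun : (fun b => WithLp.toLp 2 fun a => ((z • Y) b a).re : VecField P j E3) =
          z.re • (fun b => WithLp.toLp 2 fun a => (Y b a).re : VecField P j E3) + z.im • (fun b => WithLp.toLp 2 fun a => ((Complex.I • Y) b a).re : VecField P j E3) := by
        funext b; ext a; simp [Complex.mul_re]; ring
      rw [hfun]; exact Sr.add_mem (Sr.smul_mem _ hY.1) (Sr.smul_mem _ hY.2)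
    · have hfun : (fun b => WithLp.toLp 2 fun a => ((Complex.I • (z • Y)) b a).re : VecField P j E3) =
          z.re • (fun b => WithLp.toLp 2 fun a => ((Complex.I • Y) b a).re : VecField P j E3) + (-z.im) • (fun b => WithLp.toLp 2 fun a => (Y b a).re : VecField P j E3) := by
        funext b; ext a; simp [Complex.mul_re, Complex.mul_im]; ring
      rw [hfun]; exact Sr.add_mem (Sr.smul_mem _ hY.2) (Sr.smul_mem _ hY.1)

/-- **DECOMPOSITION INTO REAL AND IMAGINARY PARTS**: `X = cplxVec (Re X) + i · cplxVec (Im X)` with `Im X = −Re (i·X)` componentwise. [cite: Balaban1989LargeFieldI, Prop. 1 p.194 (bookkeeping)] -/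
theorem eq_cplxVec_re_add_I_smul (X : VecField P j (EuclideanSpace ℂ (Fin 3))) :
    X = cplxVec (fun b => WithLp.toLp 2 fun a => (X b a).re : VecField P j E3) +
      Complex.I • cplxVec (-(fun b => WithLp.toLp 2 fun a => ((Complex.I • X) b a).re : VecField P j E3)) := by
  funext b; ext a
  simp only [cplxVec, Pi.add_apply, Pi.smul_apply, Pi.neg_apply, PiLp.add_apply, PiLp.smul_apply, PiLp.neg_apply, smul_eq_mul]
  apply Complex.ext <;> simp

/-- ★★ **THE COMPLEXIFICATION OF A REAL GAUGE SLICE.**  For every real subspace `Sr` of real bond fields there is a complex subspace `S` of complex bond fields which is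
CONJUGATION-STABLE (`conjVec S ⊆ S`), whose real fields are exactly `Sr` (`cplxVec p ∈ S ↔ p ∈ Sr`), and every element of which is `cplxVec p + i · cplxVec q` with `p, q ∈ Sr` —
the slice `S` the w1 lineage's minimiser-family theorems quantify over, for the sibling lanes' REAL gauge conditions. (Witness: the ℂ-span of `cplxVec '' Sr`.)
[cite: Balaban1985Variational, Sect. G p.305 («we fix a gauge condition»), p.307 («the equations … are valid for Gᶜ-valued fields»); Balaban1989LargeFieldI, Prop. 1 p.194 («B′ ∈ 𝔤ᶜ»)] -/
theorem exists_sliceComplexification (Sr : Submodule ℝ (VecField P j E3)) :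
    ∃ S : Submodule ℂ (VecField P j (EuclideanSpace ℂ (Fin 3))),
      (∀ X ∈ S, conjVec X ∈ S) ∧ (∀ p : VecField P j E3, cplxVec p ∈ S ↔ p ∈ Sr) ∧
        ∀ X ∈ S, ∃ p ∈ Sr, ∃ q ∈ Sr, X = cplxVec p + Complex.I • cplxVec q := by
  refine ⟨Submodule.span ℂ (cplxVec '' (Sr : Set (VecField P j E3))), fun X hX => conjVec_mem_span_cplxVec _ hX, fun p => ⟨fun hp => ?_, fun hp => ?_⟩,
    fun X hX => ?_⟩
  · have h := (re_mem_of_mem_span_cplxVec Sr hp).1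
    have hfun : (fun b => WithLp.toLp 2 fun a => (cplxVec p b a).re : VecField P j E3) = p := by
      funext b; ext a; simp [cplxVec]
    rwa [hfun] at h
  · exact Submodule.subset_span ⟨p, hp, rfl⟩
  · obtain ⟨h1, h2⟩ := re_mem_of_mem_span_cplxVec Sr hX
    exact ⟨_, h1, _, Sr.neg_mem h2, eq_cplxVec_re_add_I_smul X⟩

end Literature.MathematicalPhysics.QuantumFieldTheory.Balaban1983to89.B15Prop1SliceComplexification

end
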